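import Summits.Ventures.LatticeQCDFlow.Exactness.Phi4MetropolisScan
import Summits.Ventures.LatticeQCDFlow.Exactness.ReversibleDirichletFloor
import Summits.Ventures.LatticeQCDFlow.Exactness.Phi4HMCTauIntFloor
import HarnessLib

/-!
# The carré du champ of an HMC-type update through phase space, and the floor `τ_int,traj(f) ≥ 2 Var(f)/⟨(Δf)²⟩_acc − ½`

HONEST FRAMING: exact (Metropolis-corrected) sampling algorithms for lattice gauge theory;
figures of merit are autocorrelation/cost numbers at stated couplings and volumes; no
continuum-physics claim.  (SCALAR calibration rung S0-A: not a gauge result.)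

Venture `LatticeQCDFlow` (cell pub-lqcd), topic `Exactness`; FANOUT row 2 (`s0-phi4`, HMC arm — the
row's "dynamical exponents z" deliverable from the side of THEOREMS; gen-13 typed the local arm and
marked the HMC arm NOT CLAIMED).  NEW WORK of the cell, composing
`Exactness/ReversibleDirichletFloor.lean` (`RevOp.tauInt_ge_of_integral_carre_le`: for a reversible
Markov contraction, `∫ Γ w ≤ D ⇒ τ_int ≥ 2 C(0)/D − ½`) with row 2's HMC-type operator
`hmcOpOf J λ Ψ` of `Exactness/Phi4HMCExact.lean` (refresh `p ∼ N(0,1)^Λ`, propose `Ψ(φ, p)` for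
ANY measurable Lebesgue-preserving involution `Ψ` of phase space, Metropolis test) and its
bounded-observable theory (`Phi4HMCTauIntFloor`, `Phi4HMCReversible`).  Nothing is cited as a fact.

## What is proved (`Λ = Fin (n+1)`, `H = S(φ) + ½Σp²`, `a = min(1, e^{−ΔH})`, `Z_p = ∫ e^{−½Σp²}`)

* `bddObs_hmcOpOf`, `hmcOpOf_add_mul_bddObs`, `hmcOpOf_reversible_bddObs`,
  `hmcOpOf_contraction_bddObs`, `hmcOpOf_one` — the update is a reversible Markov
  `L²(e^{−S})`-contraction on the class `BddObs` (wrappers of the tree's theorems in the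
  admissible-class format of `RevOp`);
* `hmcOpOf_sq_dev_eq` — the carré du champ at `φ` is the momentum average of the ACCEPTED squared
  jump: `K[(g − g φ)²](φ) = Z_p⁻¹ ∫ a(φ,p) (g((Ψ(φ,p)).1) − g φ)² e^{−½Σp²} dp` (a rejected
  trajectory does not move);
* `integrable_involAccept_mul_sq_sub`, **`integral_hmcOpOf_sq_dev_eq`** — integrated against
  `e^{−S}` it is a phase-space integral: `∫ K[(g − g φ)²](φ) e^{−S(φ)} dφ = Z_p⁻¹ ∫∫ a (g∘fst∘Ψ − g∘fst)² e^{−H}`;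
* **`hmc_tauInt_ge_of_msd_le`** — every `λ > 0`, real `J`, involution `Ψ`, bounded measurable `f`,
  `g = f − ⟨f⟩`: if the MEAN SQUARED ACCEPTED JUMP of `f` per update obeys
  `∫∫ a (f∘fst∘Ψ − f∘fst)² e^{−H} ≤ D · Z_p Z` and the autocorrelation series of `g` is summable
  with `ρ_g(1) < 1`, then `τ_int(f) ≥ 2 Var(f)/D − ½` (per update = per trajectory);
  **`hmc_tauInt_ge_msd`** — the sharpest instance `D = ⟨(Δf)²⟩_acc` itself;
  `hmcPhi4_tauInt_ge_of_msd_le` — row 2's qpq-leapfrog HMC (every `δ`, `N`).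

Reading (no numerics implied): for the HMC arm the certified conversion between a measurable column —
the equilibrium mean squared accepted jump of an observable per trajectory — and its integrated
autocorrelation time is `τ_int ≥ 2 Var(f)/⟨(Δf)²⟩_acc − ½`, exactly as for the local arm per
proposal; what differs is the size of the jump, which for HMC is not local.  The two explicit
HMC floors of the cell (`Phi4HMCActionCSD`: `⟨(ΔS)²⟩_acc ≤ 16/e² + 4V` for EVERY `Ψ`;
`Phi4HMCOneStepCSD`: `⟨(ΔM)²⟩_acc ≤ V δ²` for one leapfrog step) are instances.  NOT CLAIMED:
`ρ_g(1) < 1` / summability for any run (hypotheses); unbounded observables (the clipped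
magnetisation / action are covered at every clip level, `M` and `S` themselves are not typed here).
-/

namespace Summit.Ventures.LatticeQCDFlow.Exactness

open Real MeasureTheory Filter Finset
open Summit.Ventures.LatticeQCDFlow.Scoring

section CarreDuChamp

variable {n : ℕ}

/-- The HMC-type update maps the bounded measurable class to itself. -/
theorem bddObs_hmcOpOf (J : Fin (n + 1) → Fin (n + 1) → ℝ) (lam : ℝ)
    {Ψ : (Fin (n + 1) → ℝ) × (Fin (n + 1) → ℝ) → (Fin (n + 1) → ℝ) × (Fin (n + 1) → ℝ)}
    (hΨm : Measurable Ψ) {f : (Fin (n + 1) → ℝ) → ℝ} (hf : BddObs f) :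
    BddObs (hmcOpOf J lam Ψ f) := by
  obtain ⟨hfm, B, hfb⟩ := hf
  obtain ⟨hm, hb⟩ := hmcOpOf_bdd J lam hΨm hfm hfb
  exact ⟨hm, B, hb⟩

/-- Linearity on the class. -/
theorem hmcOpOf_add_mul_bddObs (J : Fin (n + 1) → Fin (n + 1) → ℝ) (lam : ℝ)
    {Ψ : (Fin (n + 1) → ℝ) × (Fin (n + 1) → ℝ) → (Fin (n + 1) → ℝ) × (Fin (n + 1) → ℝ)}
    (hΨm : Measurable Ψ) {f h : (Fin (n + 1) → ℝ) → ℝ} (hf : BddObs f) (hh : BddObs h) (c : ℝ)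
    (φ : Fin (n + 1) → ℝ) :
    hmcOpOf J lam Ψ (fun s => f s + c * h s) φ = hmcOpOf J lam Ψ f φ + c * hmcOpOf J lam Ψ h φ := by
  obtain ⟨hfm, Bf, hfb⟩ := hf
  obtain ⟨hhm, Bh, hhb⟩ := hh
  exact hmcOpOf_add_mul J lam hΨm hfm hhm hfb hhb c φ

/-- Reversibility on the class (coercive action). -/
theorem hmcOpOf_reversible_bddObs {J : Fin (n + 1) → Fin (n + 1) → ℝ} {lam ε K : ℝ} (hε : 0 < ε)
    (hS : ∀ φ : Fin (n + 1) → ℝ, ε * ∑ w, φ w ^ 2 - K ≤ latticePhi4Action J lam φ)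
    {Ψ : (Fin (n + 1) → ℝ) × (Fin (n + 1) → ℝ) → (Fin (n + 1) → ℝ) × (Fin (n + 1) → ℝ)}
    (hΨm : Measurable Ψ) (hΨi : Function.Involutive Ψ)
    (hΨμ : MeasurePreserving Ψ ((volume : Measure (Fin (n + 1) → ℝ)).prod volume)
      ((volume : Measure (Fin (n + 1) → ℝ)).prod volume))
    {f h : (Fin (n + 1) → ℝ) → ℝ} (hf : BddObs f) (hh : BddObs h) :
    ∫ φ, hmcOpOf J lam Ψ f φ * h φ * gibbsWeight J lam φ
      = ∫ φ, f φ * hmcOpOf J lam Ψ h φ * gibbsWeight J lam φ := by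
  obtain ⟨hfm, Bf, hfb⟩ := hf
  obtain ⟨hhm, Bh, hhb⟩ := hh
  exact hmc_reversible_of_involutive hε hS hΨm hΨi hΨμ hfm hhm hfb hhb

/-- `L²(e^{−S})` contraction on the class (coercive action). -/
theorem hmcOpOf_contraction_bddObs {J : Fin (n + 1) → Fin (n + 1) → ℝ} {lam ε K : ℝ} (hε : 0 < ε)
    (hS : ∀ φ : Fin (n + 1) → ℝ, ε * ∑ w, φ w ^ 2 - K ≤ latticePhi4Action J lam φ)
    {Ψ : (Fin (n + 1) → ℝ) × (Fin (n + 1) → ℝ) → (Fin (n + 1) → ℝ) × (Fin (n + 1) → ℝ)}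
    (hΨm : Measurable Ψ) (hΨi : Function.Involutive Ψ)
    (hΨμ : MeasurePreserving Ψ ((volume : Measure (Fin (n + 1) → ℝ)).prod volume)
      ((volume : Measure (Fin (n + 1) → ℝ)).prod volume))
    {f : (Fin (n + 1) → ℝ) → ℝ} (hf : BddObs f) :
    ∫ φ, hmcOpOf J lam Ψ f φ ^ 2 * gibbsWeight J lam φ ≤ ∫ φ, f φ ^ 2 * gibbsWeight J lam φ := by
  obtain ⟨hfm, B, hfb⟩ := hf
  exact hmcOpOf_contraction hε hS hΨm hΨi hΨμ hfm hfb

/-- **The HMC-type update is Markov**: `K 1 = 1` (accept or reject, the constant is returned). -/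
theorem hmcOpOf_one (J : Fin (n + 1) → Fin (n + 1) → ℝ) (lam : ℝ)
    (Ψ : (Fin (n + 1) → ℝ) × (Fin (n + 1) → ℝ) → (Fin (n + 1) → ℝ) × (Fin (n + 1) → ℝ))
    (φ : Fin (n + 1) → ℝ) : hmcOpOf J lam Ψ (fun _ => (1 : ℝ)) φ = 1 := by
  unfold hmcOpOf
  have e : ∀ p : Fin (n + 1) → ℝ,
      (involAccept (phi4HmcEnergy J lam) Ψ (φ, p) * 1
        + (1 - involAccept (phi4HmcEnergy J lam) Ψ (φ, p)) * 1) * momentumWeight p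
      = momentumWeight p := fun p => by ring
  simp_rw [e]
  exact div_self (momentumZ_pos n).ne'

/-- **The carré du champ of the HMC-type update**: a rejected trajectory does not move, so
`K[(g − g φ)²](φ) = Z_p⁻¹ ∫ a(φ,p) (g((Ψ(φ,p)).1) − g φ)² e^{−½Σp²} dp`. -/
theorem hmcOpOf_sq_dev_eq (J : Fin (n + 1) → Fin (n + 1) → ℝ) (lam : ℝ)
    (Ψ : (Fin (n + 1) → ℝ) × (Fin (n + 1) → ℝ) → (Fin (n + 1) → ℝ) × (Fin (n + 1) → ℝ))
    (g : (Fin (n + 1) → ℝ) → ℝ) (φ : Fin (n + 1) → ℝ) :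
    hmcOpOf J lam Ψ (fun ψ => (g ψ - g φ) ^ 2) φ
      = (∫ p, involAccept (phi4HmcEnergy J lam) Ψ (φ, p) * (g (Ψ (φ, p)).1 - g φ) ^ 2
          * momentumWeight p) / momentumZ n := by
  unfold hmcOpOf
  congr 1
  refine integral_congr_ae (Eventually.of_forall fun p => ?_)
  simp only [sub_self, zero_pow two_ne_zero, mul_zero, add_zero]

/-- The phase-space integrand `a (g∘fst∘Ψ − g∘fst)² e^{−H}` of a bounded measurable `g` is
integrable (coercive action). -/
theorem integrable_involAccept_mul_sq_sub {J : Fin (n + 1) → Fin (n + 1) → ℝ} {lam ε K : ℝ}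
    (hε : 0 < ε) (hS : ∀ φ : Fin (n + 1) → ℝ, ε * ∑ w, φ w ^ 2 - K ≤ latticePhi4Action J lam φ)
    {Ψ : (Fin (n + 1) → ℝ) × (Fin (n + 1) → ℝ) → (Fin (n + 1) → ℝ) × (Fin (n + 1) → ℝ)}
    (hΨm : Measurable Ψ) {g : (Fin (n + 1) → ℝ) → ℝ} (hgm : Measurable g) {B : ℝ}
    (hgb : ∀ φ, |g φ| ≤ B) :
    Integrable (fun z : (Fin (n + 1) → ℝ) × (Fin (n + 1) → ℝ) =>
      involAccept (phi4HmcEnergy J lam) Ψ z * (g (Ψ z).1 - g z.1) ^ 2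
        * Real.exp (-phi4HmcEnergy J lam z)) ((volume : Measure (Fin (n + 1) → ℝ)).prod volume) := by
  have hHm : Measurable (phi4HmcEnergy J lam) := measurable_phi4HmcEnergy J lam
  refine integrable_bdd_mul_weight
    (((measurable_involAccept hHm hΨm).mul
      (((hgm.comp (measurable_fst.comp hΨm)).sub (hgm.comp measurable_fst)).pow_const 2)))
    (C := (2 * B) ^ 2) (fun z => ?_) (Real.measurable_exp.comp hHm.neg)
    (fun z => (Real.exp_pos _).le) (integrable_exp_neg_phi4HmcEnergy hε hS)
  have ha0 := involAccept_nonneg (phi4HmcEnergy J lam) Ψ z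
  have ha1 := involAccept_le_one (phi4HmcEnergy J lam) Ψ z
  rw [abs_mul, abs_of_nonneg ha0, abs_of_nonneg (sq_nonneg _)]
  have hd : |g (Ψ z).1 - g z.1| ≤ 2 * B := by
    calc |g (Ψ z).1 - g z.1| ≤ |g (Ψ z).1| + |g z.1| := abs_sub _ _
      _ ≤ B + B := add_le_add (hgb _) (hgb _)
      _ = 2 * B := by ring
  have hsq : (g (Ψ z).1 - g z.1) ^ 2 ≤ (2 * B) ^ 2 := by
    rw [← sq_abs]
    exact pow_le_pow_left₀ (abs_nonneg _) hd 2
  calc involAccept (phi4HmcEnergy J lam) Ψ z * (g (Ψ z).1 - g z.1) ^ 2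
      ≤ 1 * (2 * B) ^ 2 := mul_le_mul ha1 hsq (sq_nonneg _) zero_le_one
    _ = (2 * B) ^ 2 := one_mul _

/-- **THE INTEGRATED CARRÉ DU CHAMP IS A PHASE-SPACE INTEGRAL** (Fubini; coercive action, bounded
measurable `g`): `∫ K[(g − g φ)²](φ) e^{−S(φ)} dφ = Z_p⁻¹ ∫∫ a(z) (g((Ψ z).1) − g(z.1))² e^{−H(z)} dz`. -/
theorem integral_hmcOpOf_sq_dev_eq {J : Fin (n + 1) → Fin (n + 1) → ℝ} {lam ε K : ℝ} (hε : 0 < ε)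
    (hS : ∀ φ : Fin (n + 1) → ℝ, ε * ∑ w, φ w ^ 2 - K ≤ latticePhi4Action J lam φ)
    {Ψ : (Fin (n + 1) → ℝ) × (Fin (n + 1) → ℝ) → (Fin (n + 1) → ℝ) × (Fin (n + 1) → ℝ)}
    (hΨm : Measurable Ψ) {g : (Fin (n + 1) → ℝ) → ℝ} (hgm : Measurable g) {B : ℝ}
    (hgb : ∀ φ, |g φ| ≤ B) :
    ∫ φ, hmcOpOf J lam Ψ (fun ψ => (g ψ - g φ) ^ 2) φ * gibbsWeight J lam φ
      = (∫ z, involAccept (phi4HmcEnergy J lam) Ψ z * (g (Ψ z).1 - g z.1) ^ 2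
          * Real.exp (-phi4HmcEnergy J lam z)
            ∂((volume : Measure (Fin (n + 1) → ℝ)).prod volume)) / momentumZ n := by
  set H := phi4HmcEnergy J lam with hH
  set F : (Fin (n + 1) → ℝ) × (Fin (n + 1) → ℝ) → ℝ :=
    fun z => involAccept H Ψ z * (g (Ψ z).1 - g z.1) ^ 2 with hF
  have hW : ∀ φ p, Real.exp (-H (φ, p)) = gibbsWeight J lam φ * momentumWeight p :=
    fun φ p => exp_neg_phi4HmcEnergy J lam (φ, p)
  have hint : Integrable (fun z => F z * Real.exp (-H z))
      ((volume : Measure (Fin (n + 1) → ℝ)).prod volume) :=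
    integrable_involAccept_mul_sq_sub hε hS hΨm hgm hgb
  have hop : ∀ φ, hmcOpOf J lam Ψ (fun ψ => (g ψ - g φ) ^ 2) φ
      = (∫ p, F (φ, p) * momentumWeight p) / momentumZ n := fun φ => by
    rw [hmcOpOf_sq_dev_eq]
  have hfub : ∫ φ, (∫ p, F (φ, p) * momentumWeight p) * gibbsWeight J lam φ
      = ∫ z, F z * Real.exp (-H z) ∂((volume : Measure (Fin (n + 1) → ℝ)).prod volume) := by
    rw [integral_prod _ hint]
    refine integral_congr_ae (Eventually.of_forall fun φ => ?_)
    dsimp only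
    rw [← integral_mul_const]
    refine integral_congr_ae (Eventually.of_forall fun p => ?_)
    dsimp only
    rw [hW φ p]
    ring
  calc ∫ φ, hmcOpOf J lam Ψ (fun ψ => (g ψ - g φ) ^ 2) φ * gibbsWeight J lam φ
      = ∫ φ, ((∫ p, F (φ, p) * momentumWeight p) * gibbsWeight J lam φ) / momentumZ n := by
        refine integral_congr_ae (Eventually.of_forall fun φ => ?_)
        dsimp only
        rw [hop]
        ring
    _ = (∫ z, F z * Real.exp (-H z)
          ∂((volume : Measure (Fin (n + 1) → ℝ)).prod volume)) / momentumZ n := by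
        rw [integral_div, hfub]

/-- **THE MEAN-SQUARED-JUMP FLOOR FOR EVERY HMC-TYPE UPDATE OF LATTICE φ⁴.**  Every `λ > 0`, real
`J`, measurable Lebesgue-preserving involution `Ψ` of phase space; `f` bounded measurable,
`g = f − ⟨f⟩`, `ρ_g(k) = ∫ g (K_Ψᵏ g) e^{−S} / ∫ g² e^{−S}`.  If the equilibrium mean squared
ACCEPTED jump of `f` per update obeys `∫∫ a (f((Ψ z).1) − f(z.1))² e^{−H} ≤ D · Z_p · Z` and the
autocorrelation series of `g` is summable with `ρ_g(1) < 1`, then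
`τ_int(f) = ½ + Σ_{k≥1} ρ_g(k) ≥ 2 ⟨(f − ⟨f⟩)²⟩ / D − ½`. -/
theorem hmc_tauInt_ge_of_msd_le {lam : ℝ} (hlam : 0 < lam) (J : Fin (n + 1) → Fin (n + 1) → ℝ)
    {Ψ : (Fin (n + 1) → ℝ) × (Fin (n + 1) → ℝ) → (Fin (n + 1) → ℝ) × (Fin (n + 1) → ℝ)}
    (hΨm : Measurable Ψ) (hΨi : Function.Involutive Ψ)
    (hΨμ : MeasurePreserving Ψ ((volume : Measure (Fin (n + 1) → ℝ)).prod volume)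
      ((volume : Measure (Fin (n + 1) → ℝ)).prod volume))
    {f : (Fin (n + 1) → ℝ) → ℝ} (hf : BddObs f) {D : ℝ}
    (hD : ∫ z, involAccept (phi4HmcEnergy J lam) Ψ z * (f (Ψ z).1 - f z.1) ^ 2
        * Real.exp (-phi4HmcEnergy J lam z) ∂((volume : Measure (Fin (n + 1) → ℝ)).prod volume)
        ≤ D * (momentumZ n * gibbsZ J lam))
    (hs : Summable fun k => (∫ φ, (f φ - gibbsExpect J lam f)
        * ((hmcOpOf J lam Ψ)^[k + 1] (fun ψ => f ψ - gibbsExpect J lam f)) φ * gibbsWeight J lam φ)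
        / ∫ φ, (f φ - gibbsExpect J lam f) ^ 2 * gibbsWeight J lam φ)
    (hρ : (∫ φ, (f φ - gibbsExpect J lam f)
        * hmcOpOf J lam Ψ (fun ψ => f ψ - gibbsExpect J lam f) φ * gibbsWeight J lam φ)
        / (∫ φ, (f φ - gibbsExpect J lam f) ^ 2 * gibbsWeight J lam φ) < 1) :
    2 * gibbsExpect J lam (fun φ => (f φ - gibbsExpect J lam f) ^ 2) / D - 1 / 2
      ≤ tauInt (fun k => (∫ φ, (f φ - gibbsExpect J lam f)
          * ((hmcOpOf J lam Ψ)^[k] (fun ψ => f ψ - gibbsExpect J lam f)) φ * gibbsWeight J lam φ)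
          / ∫ φ, (f φ - gibbsExpect J lam f) ^ 2 * gibbsWeight J lam φ) := by
  have hco := latticePhi4Action_coercive hlam J
  have hZ := gibbsZ_pos hlam J
  have hZp := momentumZ_pos n
  obtain ⟨hfm, B, hfb⟩ := hf
  obtain ⟨hgm, hgb, -⟩ := centred_observable hlam J hfm hfb
  have hg : BddObs (fun ψ => f ψ - gibbsExpect J lam f) := ⟨hgm, _, hgb⟩
  -- the integrated carré du champ of `g` is the phase-space msd of `f`, `≤ D Z`
  have hΓ : ∫ φ, hmcOpOf J lam Ψ (fun ψ => ((f ψ - gibbsExpect J lam f)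
      - (f φ - gibbsExpect J lam f)) ^ 2) φ * gibbsWeight J lam φ ≤ D * gibbsZ J lam := by
    rw [integral_hmcOpOf_sq_dev_eq one_pos hco hΨm hgm hgb]
    have e : ∀ z : (Fin (n + 1) → ℝ) × (Fin (n + 1) → ℝ),
        involAccept (phi4HmcEnergy J lam) Ψ z * ((f (Ψ z).1 - gibbsExpect J lam f)
          - (f z.1 - gibbsExpect J lam f)) ^ 2 * Real.exp (-phi4HmcEnergy J lam z)
        = involAccept (phi4HmcEnergy J lam) Ψ z * (f (Ψ z).1 - f z.1) ^ 2
          * Real.exp (-phi4HmcEnergy J lam z) := fun z => by ring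
    simp_rw [e]
    rw [div_le_iff₀ hZp]
    calc _ ≤ D * (momentumZ n * gibbsZ J lam) := hD
      _ = D * gibbsZ J lam * momentumZ n := by ring
  have hfloor := RevOp.tauInt_ge_of_integral_carre_le (μ := volume) (A := BddObs)
    (K := hmcOpOf J lam Ψ) (w := gibbsWeight J lam)
    (fun φ => (gibbsWeight_pos J lam φ).le) (bddObs_const 1)
    (fun f h hf hh => bddObs_integrable_mul_mul_gibbsWeight one_pos hco hf hh)
    (fun f h c hf hh => bddObs_add_mul hf hh c)
    (fun f hf => bddObs_hmcOpOf J lam hΨm hf)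
    (fun f h c hf hh x => hmcOpOf_add_mul_bddObs J lam hΨm hf hh c x)
    (fun f h hf hh => hmcOpOf_reversible_bddObs one_pos hco hΨm hΨi hΨμ hf hh)
    (fun f hf => hmcOpOf_contraction_bddObs one_pos hco hΨm hΨi hΨμ hf)
    (fun φ => hmcOpOf_one J lam Ψ φ) hg (bddObs_sq hg) hΓ hs hρ
  -- `2 ⟨g²⟩ / D = 2 ∫g²w / (D Z)`
  have e : ∀ P : ℝ, 2 * (P / gibbsZ J lam) / D - 1 / 2 = 2 * P / (D * gibbsZ J lam) - 1 / 2 := by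
    intro P
    rw [mul_div_assoc, div_div, mul_comm (gibbsZ J lam) D, ← mul_div_assoc]
  unfold gibbsExpect
  exact (e _).le.trans hfloor

/-- **The sharpest instance: `τ_int(f) ≥ 2 Var(f)/⟨(Δf)²⟩_acc − ½`**, with
`⟨(Δf)²⟩_acc = ∫∫ a (f((Ψ z).1) − f(z.1))² e^{−H} / (Z_p Z)` the equilibrium mean squared accepted
jump of `f` per update (a measurable column of any run). -/
theorem hmc_tauInt_ge_msd {lam : ℝ} (hlam : 0 < lam) (J : Fin (n + 1) → Fin (n + 1) → ℝ)
    {Ψ : (Fin (n + 1) → ℝ) × (Fin (n + 1) → ℝ) → (Fin (n + 1) → ℝ) × (Fin (n + 1) → ℝ)}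
    (hΨm : Measurable Ψ) (hΨi : Function.Involutive Ψ)
    (hΨμ : MeasurePreserving Ψ ((volume : Measure (Fin (n + 1) → ℝ)).prod volume)
      ((volume : Measure (Fin (n + 1) → ℝ)).prod volume))
    {f : (Fin (n + 1) → ℝ) → ℝ} (hf : BddObs f)
    (hs : Summable fun k => (∫ φ, (f φ - gibbsExpect J lam f)
        * ((hmcOpOf J lam Ψ)^[k + 1] (fun ψ => f ψ - gibbsExpect J lam f)) φ * gibbsWeight J lam φ)
        / ∫ φ, (f φ - gibbsExpect J lam f) ^ 2 * gibbsWeight J lam φ)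
    (hρ : (∫ φ, (f φ - gibbsExpect J lam f)
        * hmcOpOf J lam Ψ (fun ψ => f ψ - gibbsExpect J lam f) φ * gibbsWeight J lam φ)
        / (∫ φ, (f φ - gibbsExpect J lam f) ^ 2 * gibbsWeight J lam φ) < 1) :
    2 * gibbsExpect J lam (fun φ => (f φ - gibbsExpect J lam f) ^ 2)
        / ((∫ z, involAccept (phi4HmcEnergy J lam) Ψ z * (f (Ψ z).1 - f z.1) ^ 2
            * Real.exp (-phi4HmcEnergy J lam z) ∂((volume : Measure (Fin (n + 1) → ℝ)).prod volume))
          / (momentumZ n * gibbsZ J lam)) - 1 / 2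
      ≤ tauInt (fun k => (∫ φ, (f φ - gibbsExpect J lam f)
          * ((hmcOpOf J lam Ψ)^[k] (fun ψ => f ψ - gibbsExpect J lam f)) φ * gibbsWeight J lam φ)
          / ∫ φ, (f φ - gibbsExpect J lam f) ^ 2 * gibbsWeight J lam φ) := by
  have hZ := gibbsZ_pos hlam J
  have hZp := momentumZ_pos n
  refine hmc_tauInt_ge_of_msd_le hlam J hΨm hΨi hΨμ hf (le_of_eq ?_) hs hρ
  rw [div_mul_cancel₀ _ (mul_pos hZp hZ).ne']

/-- **Row 2's HMC** (qpq leapfrog, every step size `δ`, every trajectory length `N`; every `λ > 0`,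
real `J`): a bound `D` on the mean squared accepted jump of `f` per trajectory (in units of
`Z_p Z`) certifies `τ_int,traj(f) ≥ 2 Var(f)/D − ½`. -/
theorem hmcPhi4_tauInt_ge_of_msd_le {lam : ℝ} (hlam : 0 < lam) (J : Fin (n + 1) → Fin (n + 1) → ℝ)
    (δ : ℝ) (N : ℕ) {f : (Fin (n + 1) → ℝ) → ℝ} (hf : BddObs f) {D : ℝ}
    (hD : ∫ z, involAccept (phi4HmcEnergy J lam) (hmcProposal J lam δ N) z
        * (f (hmcProposal J lam δ N z).1 - f z.1) ^ 2 * Real.exp (-phi4HmcEnergy J lam z)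
          ∂((volume : Measure (Fin (n + 1) → ℝ)).prod volume)
        ≤ D * (momentumZ n * gibbsZ J lam))
    (hs : Summable fun k => (∫ φ, (f φ - gibbsExpect J lam f)
        * ((hmcOpPhi4 J lam δ N)^[k + 1] (fun ψ => f ψ - gibbsExpect J lam f)) φ * gibbsWeight J lam φ)
        / ∫ φ, (f φ - gibbsExpect J lam f) ^ 2 * gibbsWeight J lam φ)
    (hρ : (∫ φ, (f φ - gibbsExpect J lam f)
        * hmcOpPhi4 J lam δ N (fun ψ => f ψ - gibbsExpect J lam f) φ * gibbsWeight J lam φ)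
        / (∫ φ, (f φ - gibbsExpect J lam f) ^ 2 * gibbsWeight J lam φ) < 1) :
    2 * gibbsExpect J lam (fun φ => (f φ - gibbsExpect J lam f) ^ 2) / D - 1 / 2
      ≤ tauInt (fun k => (∫ φ, (f φ - gibbsExpect J lam f)
          * ((hmcOpPhi4 J lam δ N)^[k] (fun ψ => f ψ - gibbsExpect J lam f)) φ * gibbsWeight J lam φ)
          / ∫ φ, (f φ - gibbsExpect J lam f) ^ 2 * gibbsWeight J lam φ) :=
  hmc_tauInt_ge_of_msd_le hlam J (measurable_hmcProposal J lam δ N)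
    (hmcProposal_involutive J lam δ N) (measurePreserving_hmcProposal J lam δ N) hf hD hs hρ

end CarreDuChamp

end Summit.Ventures.LatticeQCDFlow.Exactness
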